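import Literature.Geometry.GaugeTheory.AsdModuliSpace
import Literature.Geometry.Riemannian.SelfDualMetricFrameProofs
import HarnessLib

/-!
# Anti-self-duality and the curvature density do not depend on the orthonormal frame

Topic `Literature/Geometry/GaugeTheory`; companion *proofs* file (theorems only: no definition, no
named fact) of `AsdModuliSpace.lean`, which writes the anti-self-duality equation `F⁺ = 0` of an
`ℍ`-valued 2-form frame-wise — `IsASDIn F e : F(e₀,e₁) + F(e₂,e₃) = F(e₀,e₂) + F(e₃,e₁) =
F(e₀,e₃) + F(e₁,e₂) = 0` in a positively oriented `g`-orthonormal frame `e`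
(Labastida–Mariño 2005, (2.17)–(2.19)) — and the pointwise norm
`|F|²_g(x) = Σ_{a<b} |F(e_a, e_b)|²` (`twoFormNormSq`, Donaldson–Kronheimer 1990, §2.1) on a frame
*chosen* at each point, recording in its docstrings, without proof, that both are independent of
the frame. This file proves it, for every `F : V → V → ℍ` that is additive and homogeneous in its
first slot and skew (`F(u, v) = -F(v, u)`) — in particular for the curvature
`F_A = dA + A ∧ A` of a connection on `P_k` (`SpOneConnection.curvature`, which is shown to be of
this kind):

* `IsASDIn.of_isPosOrthonormalFrame`, `isASDIn_iff_of_isPosOrthonormalFrame` — at a point `x`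
  of an oriented Riemannian 4-manifold, `F` is anti-self-dual in one positively oriented
  `g_x`-orthonormal frame iff it is in every such frame (`Λ²₊` is an `SO(4)`-submodule of `Λ²`,
  Atiyah–Hitchin–Singer 1978, §1);
* `twoFormNormSq_eq_of_isOrthonormalFrame` — `|F|²_g(x) = Σ_{a<b} |F(e_a, e_b)|²` for EVERY
  `g_x`-orthonormal frame `e`, of either orientation (the norm induced by `g_x` on `Λ² ⊗ ℍ`,
  Donaldson–Kronheimer 1990, §2.1);
* `SpOneConnection.curvature_add_left / curvature_smul_left / curvature_swap` — the curvature of a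
  connection is skew and bi-additive (it is built from the alternating `mextDeriv` and a
  commutator), whence `SpOneConnection.isASD_iff_forall_exists` (anti-self-duality may be tested
  on ONE positive orthonormal frame per point) and `SpOneConnection.curvatureDensity_eq_sum`,
  `AsdModuliSpace.density_eq_sum` (the curvature density computed in ANY orthonormal frame).

## The argument

Frame-wise, as in the tree's `Literature.Geometry.Riemannian.exists_blockC_eq_conj`
(`SelfDualMetricFrameProofs.lean`, there for Hamilton's curvature block `C`): the orthonormal
frames at `x` of one orientation form an `SO(4)`-torsor and `SO(4)` is generated by the Givens
rotations in the coordinate planes `(0,1)`, `(1,2)`, `(2,3)`; six such rotations join `e` to `e'`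
up to the reversal of one vector, which is excluded when the orientations agree. We first isolate
this mechanism as an induction principle for an ARBITRARY predicate on frames
(`IsOrthonormalFrame.exists_givens_chain`, `IsOrthonormalFrame.givens_induction` for like-oriented
frames, `IsOrthonormalFrame.givens_induction_neg` for all frames when the predicate is also stable
under the reversal of `e₀`), valid for any `C^n` pseudo-Riemannian metric on a manifold modelled
on a `4`-dimensional space. Then we check by bilinear algebra that a Givens rotation of the frame
rotates the three self-dual components `(F₀₁ + F₂₃, F₀₂ + F₃₁, F₀₃ + F₁₂)` among themselves
(`IsASDIn.frame_rot01/12/23`) and preserves `Σ_{a<b} |F(e_a,e_b)|²`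
(`sixNormSq_frame_rot01/12/23`, `sixNormSq_update_neg`).

## References

* M. F. Atiyah, N. J. Hitchin, I. M. Singer, *Self-duality in four-dimensional Riemannian
  geometry*, Proc. R. Soc. Lond. A 362 (1978) 425–461, §1 (`Λ² = Λ²₊ ⊕ Λ²₋` under `SO(4)`).
  [AtiyahHitchinSinger1978]
* S. K. Donaldson, P. B. Kronheimer, *The Geometry of Four-Manifolds* (1990), §2.1 (`|F_A|²`,
  anti-self-dual connections). [DonaldsonKronheimer1990]
* J. Labastida, M. Mariño, *Topological Quantum Field Theory and Four Manifolds* (2005),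
  (2.17)–(2.19). [LabastidaMarino2005]
* A. L. Besse, *Einstein Manifolds* (1987), 1.126–1.128. [Besse1987]
-/

noncomputable section

open scoped Manifold ContDiff Topology Quaternion
open Set Function Module
open Literature.Geometry.Lorentzian (PseudoRiemannianMetric)
open Literature.Geometry.Riemannian (exists_circle_annihilate frameOfFin
  exists_alternating_pos_of_isPosFrame exists_isOrthonormalFrame_isPosFrame)
open Literature.Topology.FourManifolds (SmoothOrientation)

namespace Literature.Geometry.GaugeTheory

/-! ### Joining orthonormal frames by Givens rotations: an induction principle -/

section Chain

variable {E : Type*} [NormedAddCommGroup E] [NormedSpace ℝ E] {H : Type*} [TopologicalSpace H]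
  {I : ModelWithCorners ℝ E H} {M : Type*} [TopologicalSpace M] [ChartedSpace H M]
  [IsManifold I ∞ M] {n : ℕ∞ω} [FiniteDimensional ℝ E]
  {g : PseudoRiemannianMetric I n E (TangentSpace I : M → Type _)}

/-- **Six Givens rotations join two orthonormal frames up to one sign.** Let `g` be a `C^n`
pseudo-Riemannian metric on a manifold modelled on a `4`-dimensional space, `e, e'` two
`g_x`-orthonormal 4-frames at `x`, `vol` any alternating `4`-form on `T_x M`, and `P` a property of
4-frames which `e` has and which is passed on under the Givens rotations of a frame in the
coordinate planes `(0,1)`, `(1,2)`, `(2,3)`. Then there is a `g_x`-orthonormal frame `f` with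
`P f`, `vol f = vol e`, agreeing with `e'` in the slots `1, 2, 3` and with `f₀ = ± e'₀`: kill the
coordinates of `e'₃` along `f₀, f₁, f₂` by three rotations (`exists_circle_annihilate`), then those
of `e'₂` along `f₀, f₁`, then that of `e'₁` along `f₀` (a unit vector with one non-negative
coordinate left IS that frame vector, `IsOrthonormalFrame.eq_of_coords`). This is the mechanism of
`Literature.Geometry.Riemannian.exists_blockC_eq_conj`, isolated for an arbitrary predicate.
[cite: Besse1987, 1.126–1.128] -/
theorem _root_.Literature.Geometry.Lorentzian.PseudoRiemannianMetric.IsOrthonormalFrame.exists_givens_chain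
    (hE : finrank ℝ E = 4) {x : M} (P : (Fin 4 → TangentSpace I x) → Prop)
    (h01 : ∀ (f : Fin 4 → TangentSpace I x) (c s : ℝ), c ^ 2 + s ^ 2 = 1 → P f →
      P ![c • f 0 + s • f 1, -s • f 0 + c • f 1, f 2, f 3])
    (h12 : ∀ (f : Fin 4 → TangentSpace I x) (c s : ℝ), c ^ 2 + s ^ 2 = 1 → P f →
      P ![f 0, c • f 1 + s • f 2, -s • f 1 + c • f 2, f 3])
    (h23 : ∀ (f : Fin 4 → TangentSpace I x) (c s : ℝ), c ^ 2 + s ^ 2 = 1 → P f →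
      P ![f 0, f 1, c • f 2 + s • f 3, -s • f 2 + c • f 3])
    (vol : TangentSpace I x [⋀^Fin 4]→ₗ[ℝ] ℝ) {e e' : Fin 4 → TangentSpace I x}
    (he : g.IsOrthonormalFrame x e) (he' : g.IsOrthonormalFrame x e') (hPe : P e) :
    ∃ f : Fin 4 → TangentSpace I x, g.IsOrthonormalFrame x f ∧ vol f = vol e ∧ P f ∧
      f 1 = e' 1 ∧ f 2 = e' 2 ∧ f 3 = e' 3 ∧ (e' 0 = f 0 ∨ e' 0 = -f 0) := by
  have lin : ∀ (v X Y : TangentSpace I x) (a b : ℝ),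
      g.val x v (a • X + b • Y) = a * g.val x v X + b * g.val x v Y := fun v X Y a b ↦ by
    rw [map_add, map_smul, map_smul, smul_eq_mul, smul_eq_mul]
  -- the three Givens steps along a chain of frames starting at `e`
  have step01 : ∀ {f : Fin 4 → TangentSpace I x}, g.IsOrthonormalFrame x f → vol f = vol e →
      P f → ∀ {c s : ℝ}, c ^ 2 + s ^ 2 = 1 → ∃ f' : Fin 4 → TangentSpace I x,
        g.IsOrthonormalFrame x f' ∧ vol f' = vol e ∧ P f' ∧
        f' 0 = c • f 0 + s • f 1 ∧ f' 1 = -s • f 0 + c • f 1 ∧ f' 2 = f 2 ∧ f' 3 = f 3 :=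
    fun {f} hf hvf hPf {c s} hcs ↦ ⟨![c • f 0 + s • f 1, -s • f 0 + c • f 1, f 2, f 3],
      hf.frame_rot01 hcs, by rw [vol.map_frame_rot01 f hcs, hvf], h01 f c s hcs hPf,
      rfl, rfl, rfl, rfl⟩
  have step12 : ∀ {f : Fin 4 → TangentSpace I x}, g.IsOrthonormalFrame x f → vol f = vol e →
      P f → ∀ {c s : ℝ}, c ^ 2 + s ^ 2 = 1 → ∃ f' : Fin 4 → TangentSpace I x,
        g.IsOrthonormalFrame x f' ∧ vol f' = vol e ∧ P f' ∧
        f' 0 = f 0 ∧ f' 1 = c • f 1 + s • f 2 ∧ f' 2 = -s • f 1 + c • f 2 ∧ f' 3 = f 3 :=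
    fun {f} hf hvf hPf {c s} hcs ↦ ⟨![f 0, c • f 1 + s • f 2, -s • f 1 + c • f 2, f 3],
      hf.frame_rot12 hcs, by rw [vol.map_frame_rot12 f hcs, hvf], h12 f c s hcs hPf,
      rfl, rfl, rfl, rfl⟩
  have step23 : ∀ {f : Fin 4 → TangentSpace I x}, g.IsOrthonormalFrame x f → vol f = vol e →
      P f → ∀ {c s : ℝ}, c ^ 2 + s ^ 2 = 1 → ∃ f' : Fin 4 → TangentSpace I x,
        g.IsOrthonormalFrame x f' ∧ vol f' = vol e ∧ P f' ∧
        f' 0 = f 0 ∧ f' 1 = f 1 ∧ f' 2 = c • f 2 + s • f 3 ∧ f' 3 = -s • f 2 + c • f 3 :=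
    fun {f} hf hvf hPf {c s} hcs ↦ ⟨![f 0, f 1, c • f 2 + s • f 3, -s • f 2 + c • f 3],
      hf.frame_rot23 hcs, by rw [vol.map_frame_rot23 f hcs, hvf], h23 f c s hcs hPf,
      rfl, rfl, rfl, rfl⟩
  ---- Round 1: bring `e' 3` to the last position
  have R1 : ∃ f : Fin 4 → TangentSpace I x, g.IsOrthonormalFrame x f ∧ vol f = vol e ∧ P f ∧
      f 3 = e' 3 := by
    set v := e' 3
    obtain ⟨c₁, s₁, hcs₁, k₁, -⟩ := exists_circle_annihilate (g.val x v (e 0)) (g.val x v (e 1))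
    obtain ⟨f₁, of₁, vf₁, Pf₁, f₁0, f₁1, f₁2, f₁3⟩ := step01 he rfl hPe hcs₁
    have a₁ : g.val x v (f₁ 0) = 0 := by rw [f₁0, lin]; exact k₁
    obtain ⟨c₂, s₂, hcs₂, k₂, -⟩ := exists_circle_annihilate (g.val x v (f₁ 1)) (g.val x v (f₁ 2))
    obtain ⟨f₂, of₂, vf₂, Pf₂, f₂0, f₂1, f₂2, f₂3⟩ := step12 of₁ vf₁ Pf₁ hcs₂
    have b₀ : g.val x v (f₂ 0) = 0 := by rw [f₂0]; exact a₁
    have b₁ : g.val x v (f₂ 1) = 0 := by rw [f₂1, lin]; exact k₂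
    obtain ⟨c₃, s₃, hcs₃, k₃, p₃⟩ := exists_circle_annihilate (g.val x v (f₂ 2)) (g.val x v (f₂ 3))
    obtain ⟨f₃, of₃, vf₃, Pf₃, f₃0, f₃1, f₃2, f₃3⟩ := step23 of₂ vf₂ Pf₂ hcs₃
    have c₀' : g.val x v (f₃ 0) = 0 := by rw [f₃0]; exact b₀
    have c₁' : g.val x v (f₃ 1) = 0 := by rw [f₃1]; exact b₁
    have c₂' : g.val x v (f₃ 2) = 0 := by rw [f₃2, lin]; exact k₃
    have c₃' : 0 ≤ g.val x v (f₃ 3) := by rw [f₃3, lin]; exact p₃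
    have hv3 : v = f₃ 3 := of₃.eq_of_coords hE (he'.1 3) 3 (fun j hj ↦ by
      fin_cases j
      · exact c₀'
      · exact c₁'
      · exact c₂'
      · exact absurd rfl hj) c₃'
    exact ⟨f₃, of₃, vf₃, Pf₃, hv3.symm⟩
  ---- Round 2: bring `e' 2` to position `2`, keeping `e' 3`
  have R2 : ∃ f : Fin 4 → TangentSpace I x, g.IsOrthonormalFrame x f ∧ vol f = vol e ∧ P f ∧
      f 2 = e' 2 ∧ f 3 = e' 3 := by
    obtain ⟨f, of, vf, Pf, hf3⟩ := R1
    set v := e' 2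
    have hv3 : g.val x v (f 3) = 0 := by rw [hf3]; exact he'.2 2 3 (by decide)
    obtain ⟨c₁, s₁, hcs₁, k₁, -⟩ := exists_circle_annihilate (g.val x v (f 0)) (g.val x v (f 1))
    obtain ⟨f₁, of₁, vf₁, Pf₁, f₁0, f₁1, f₁2, f₁3⟩ := step01 of vf Pf hcs₁
    have a₁ : g.val x v (f₁ 0) = 0 := by rw [f₁0, lin]; exact k₁
    obtain ⟨c₂, s₂, hcs₂, k₂, p₂⟩ := exists_circle_annihilate (g.val x v (f₁ 1)) (g.val x v (f₁ 2))
    obtain ⟨f₂, of₂, vf₂, Pf₂, f₂0, f₂1, f₂2, f₂3⟩ := step12 of₁ vf₁ Pf₁ hcs₂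
    have b₀ : g.val x v (f₂ 0) = 0 := by rw [f₂0]; exact a₁
    have b₁ : g.val x v (f₂ 1) = 0 := by rw [f₂1, lin]; exact k₂
    have b₂ : 0 ≤ g.val x v (f₂ 2) := by rw [f₂2, lin]; exact p₂
    have b₃ : g.val x v (f₂ 3) = 0 := by rw [f₂3, f₁3]; exact hv3
    have hv2 : v = f₂ 2 := of₂.eq_of_coords hE (he'.1 2) 2 (fun j hj ↦ by
      fin_cases j
      · exact b₀
      · exact b₁
      · exact absurd rfl hj
      · exact b₃) b₂
    exact ⟨f₂, of₂, vf₂, Pf₂, hv2.symm, by rw [f₂3, f₁3, hf3]⟩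
  ---- Round 3: bring `e' 1` to position `1`, keeping `e' 2`, `e' 3`
  have R3 : ∃ f : Fin 4 → TangentSpace I x, g.IsOrthonormalFrame x f ∧ vol f = vol e ∧ P f ∧
      f 1 = e' 1 ∧ f 2 = e' 2 ∧ f 3 = e' 3 := by
    obtain ⟨f, of, vf, Pf, hf2, hf3⟩ := R2
    set v := e' 1
    have hv2 : g.val x v (f 2) = 0 := by rw [hf2]; exact he'.2 1 2 (by decide)
    have hv3 : g.val x v (f 3) = 0 := by rw [hf3]; exact he'.2 1 3 (by decide)
    obtain ⟨c₁, s₁, hcs₁, k₁, p₁⟩ := exists_circle_annihilate (g.val x v (f 0)) (g.val x v (f 1))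
    obtain ⟨f₁, of₁, vf₁, Pf₁, f₁0, f₁1, f₁2, f₁3⟩ := step01 of vf Pf hcs₁
    have a₀ : g.val x v (f₁ 0) = 0 := by rw [f₁0, lin]; exact k₁
    have a₁ : 0 ≤ g.val x v (f₁ 1) := by rw [f₁1, lin]; exact p₁
    have a₂ : g.val x v (f₁ 2) = 0 := by rw [f₁2]; exact hv2
    have a₃ : g.val x v (f₁ 3) = 0 := by rw [f₁3]; exact hv3
    have hv1 : v = f₁ 1 := of₁.eq_of_coords hE (he'.1 1) 1 (fun j hj ↦ by
      fin_cases j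
      · exact a₀
      · exact absurd rfl hj
      · exact a₂
      · exact a₃) a₁
    exact ⟨f₁, of₁, vf₁, Pf₁, hv1.symm, by rw [f₁2, hf2], by rw [f₁3, hf3]⟩
  ---- Round 4: the first vector is `± e' 0`
  obtain ⟨f, of, vf, Pf, hf1, hf2, hf3⟩ := R3
  have k1 : g.val x (e' 0) (f 1) = 0 := by rw [hf1]; exact he'.2 0 1 (by decide)
  have k2 : g.val x (e' 0) (f 2) = 0 := by rw [hf2]; exact he'.2 0 2 (by decide)
  have k3 : g.val x (e' 0) (f 3) = 0 := by rw [hf3]; exact he'.2 0 3 (by decide)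
  refine ⟨f, of, vf, Pf, hf1, hf2, hf3, ?_⟩
  exact of.eq_or_eq_neg_of_coords hE (he'.1 0) 0 (fun j hj ↦ by
    fin_cases j
    · exact absurd rfl hj
    · exact k1
    · exact k2
    · exact k3)

/-- **Induction along Givens rotations, like-oriented frames.** A property of 4-frames at `x`
stable under the Givens rotations in the coordinate planes `(0,1)`, `(1,2)`, `(2,3)` passes from a
`g_x`-orthonormal frame `e` to every `g_x`-orthonormal frame `e'` of the same orientation (some
alternating `4`-form is positive on `(e, e')`): the orthonormal frames of one orientation form an
`SO(4)`-torsor and `SO(4)` is generated by these rotations (Besse 1987, 1.126; frame-wise: the sign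
`f₀ = -e'₀` left by `exists_givens_chain` would reverse the alternating form).
[cite: Besse1987, 1.126–1.128] -/
theorem _root_.Literature.Geometry.Lorentzian.PseudoRiemannianMetric.IsOrthonormalFrame.givens_induction
    (hE : finrank ℝ E = 4) {x : M} (P : (Fin 4 → TangentSpace I x) → Prop)
    (h01 : ∀ (f : Fin 4 → TangentSpace I x) (c s : ℝ), c ^ 2 + s ^ 2 = 1 → P f →
      P ![c • f 0 + s • f 1, -s • f 0 + c • f 1, f 2, f 3])
    (h12 : ∀ (f : Fin 4 → TangentSpace I x) (c s : ℝ), c ^ 2 + s ^ 2 = 1 → P f →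
      P ![f 0, c • f 1 + s • f 2, -s • f 1 + c • f 2, f 3])
    (h23 : ∀ (f : Fin 4 → TangentSpace I x) (c s : ℝ), c ^ 2 + s ^ 2 = 1 → P f →
      P ![f 0, f 1, c • f 2 + s • f 3, -s • f 2 + c • f 3])
    (vol : TangentSpace I x [⋀^Fin 4]→ₗ[ℝ] ℝ) {e e' : Fin 4 → TangentSpace I x}
    (he : g.IsOrthonormalFrame x e) (he' : g.IsOrthonormalFrame x e') (hvol : 0 < vol e * vol e')
    (hPe : P e) : P e' := by
  obtain ⟨f, -, vf, Pf, hf1, hf2, hf3, h0 | h0⟩ :=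
    he.exists_givens_chain hE P h01 h12 h23 vol he' hPe
  · have hef : e' = f := by
      funext k
      fin_cases k
      · exact h0
      · exact hf1.symm
      · exact hf2.symm
      · exact hf3.symm
    rw [hef]
    exact Pf
  · exfalso
    have hef : e' = update f 0 (-f 0) := by
      funext k
      by_cases hk : k = 0
      · subst hk
        rw [update_self]
        exact h0
      · rw [update_of_ne hk]
        fin_cases k
        · exact absurd rfl hk
        · exact hf1.symm
        · exact hf2.symm
        · exact hf3.symm
    have hve : vol e' = -vol e := by
      rw [hef, vol.map_update_neg, update_eq_self, vf]
    have : vol e * vol e' = -(vol e * vol e) := by rw [hve]; ring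
    rw [this] at hvol
    linarith [mul_self_nonneg (vol e)]

/-- **Induction along Givens rotations, all frames.** A property of 4-frames at `x` stable under
the Givens rotations in the planes `(0,1)`, `(1,2)`, `(2,3)` and under the reversal of the first
vector passes from one `g_x`-orthonormal frame to every other (`O(4)` is generated by `SO(4)` and
one reflection; Besse 1987, 1.126). [cite: Besse1987, 1.126–1.128] -/
theorem _root_.Literature.Geometry.Lorentzian.PseudoRiemannianMetric.IsOrthonormalFrame.givens_induction_neg
    (hE : finrank ℝ E = 4) {x : M} (P : (Fin 4 → TangentSpace I x) → Prop)
    (h01 : ∀ (f : Fin 4 → TangentSpace I x) (c s : ℝ), c ^ 2 + s ^ 2 = 1 → P f →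
      P ![c • f 0 + s • f 1, -s • f 0 + c • f 1, f 2, f 3])
    (h12 : ∀ (f : Fin 4 → TangentSpace I x) (c s : ℝ), c ^ 2 + s ^ 2 = 1 → P f →
      P ![f 0, c • f 1 + s • f 2, -s • f 1 + c • f 2, f 3])
    (h23 : ∀ (f : Fin 4 → TangentSpace I x) (c s : ℝ), c ^ 2 + s ^ 2 = 1 → P f →
      P ![f 0, f 1, c • f 2 + s • f 3, -s • f 2 + c • f 3])
    (hneg : ∀ f : Fin 4 → TangentSpace I x, P f → P (update f 0 (-f 0)))
    {e e' : Fin 4 → TangentSpace I x} (he : g.IsOrthonormalFrame x e)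
    (he' : g.IsOrthonormalFrame x e') (hPe : P e) : P e' := by
  obtain ⟨f, -, -, Pf, hf1, hf2, hf3, h0 | h0⟩ :=
    he.exists_givens_chain hE P h01 h12 h23 0 he' hPe
  · have hef : e' = f := by
      funext k
      fin_cases k
      · exact h0
      · exact hf1.symm
      · exact hf2.symm
      · exact hf3.symm
    rw [hef]
    exact Pf
  · have hef : e' = update f 0 (-f 0) := by
      funext k
      by_cases hk : k = 0
      · subst hk
        rw [update_self]
        exact h0
      · rw [update_of_ne hk]
        fin_cases k
        · exact absurd rfl hk
        · exact hf1.symm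
        · exact hf2.symm
        · exact hf3.symm
    rw [hef]
    exact hneg f Pf

end Chain

/-! ### Skew bi-additive `ℍ`-valued 2-forms under Givens rotations of the frame -/

section SkewForm

variable {V : Type*} [AddCommGroup V] [Module ℝ V] {F : V → V → ℍ}

omit [Module ℝ V] in
/-- A form additive in the first slot and skew is additive in the second slot. [folklore] -/
theorem skew_add_right (hadd : ∀ u u' v, F (u + u') v = F u v + F u' v)
    (hskew : ∀ u v, F u v = -F v u) (u v v' : V) : F u (v + v') = F u v + F u v' := by
  rw [hskew u (v + v'), hadd, hskew v u, hskew v' u, neg_add, neg_neg, neg_neg]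

/-- A form homogeneous in the first slot and skew is homogeneous in the second slot. [folklore] -/
theorem skew_smul_right (hsmul : ∀ (c : ℝ) (u v : V), F (c • u) v = c • F u v)
    (hskew : ∀ u v, F u v = -F v u) (c : ℝ) (u v : V) : F u (c • v) = c • F u v := by
  rw [hskew u (c • v), hsmul, hskew v u, smul_neg, neg_neg]

omit [AddCommGroup V] [Module ℝ V] in
/-- A skew form vanishes on the diagonal (no `2`-torsion in `ℍ`). [folklore] -/
theorem skew_self (hskew : ∀ u v, F u v = -F v u) (u : V) : F u u = 0 := by
  have h := hskew u u
  have h2 : (2 : ℝ) • F u u = 0 := by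
    rw [two_smul]
    nth_rw 1 [h]
    exact neg_add_cancel _
  rcases smul_eq_zero.1 h2 with h2 | h2
  · norm_num at h2
  · exact h2

/-- **A skew bi-additive form on a plane rotation**: `F(a u + b v, c u + d v) = (ad - bc) F(u, v)`.
[folklore] -/
theorem skew_apply_combo (hadd : ∀ u u' v, F (u + u') v = F u v + F u' v)
    (hsmul : ∀ (c : ℝ) (u v : V), F (c • u) v = c • F u v) (hskew : ∀ u v, F u v = -F v u)
    (a b c d : ℝ) (u v : V) :
    F (a • u + b • v) (c • u + d • v) = (a * d - b * c) • F u v := by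
  rw [hadd, hsmul, hsmul, skew_add_right hadd hskew, skew_add_right hadd hskew,
    skew_smul_right hsmul hskew, skew_smul_right hsmul hskew, skew_smul_right hsmul hskew,
    skew_smul_right hsmul hskew, skew_self hskew, skew_self hskew, hskew v u]
  module

/-- `F(w, a u + b v) = a F(w, u) + b F(w, v)`. [folklore] -/
theorem skew_apply_right_combo (hadd : ∀ u u' v, F (u + u') v = F u v + F u' v)
    (hsmul : ∀ (c : ℝ) (u v : V), F (c • u) v = c • F u v) (hskew : ∀ u v, F u v = -F v u)
    (a b : ℝ) (w u v : V) : F w (a • u + b • v) = a • F w u + b • F w v := by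
  rw [skew_add_right hadd hskew, skew_smul_right hsmul hskew, skew_smul_right hsmul hskew]

/-- `F(a u + b v, w) = a F(u, w) + b F(v, w)`. [folklore] -/
theorem skew_apply_left_combo (hadd : ∀ u u' v, F (u + u') v = F u v + F u' v)
    (hsmul : ∀ (c : ℝ) (u v : V), F (c • u) v = c • F u v)
    (a b : ℝ) (u v w : V) : F (a • u + b • v) w = a • F u w + b • F v w := by
  rw [hadd, hsmul, hsmul]

omit [AddCommGroup V] [Module ℝ V] in
/-- The relations `F₂₃ = -F₀₁`, `F₁₃ = F₀₂`, `F₁₂ = -F₀₃` in an anti-self-dual frame, for a skew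
form. [folklore] -/
theorem IsASDIn.rel_of_skew (hskew : ∀ u v, F u v = -F v u) {f : Fin 4 → V} (h : IsASDIn F f) :
    F (f 2) (f 3) = -F (f 0) (f 1) ∧ F (f 1) (f 3) = F (f 0) (f 2) ∧
      F (f 1) (f 2) = -F (f 0) (f 3) := by
  have h0 : F (f 0) (f 1) + F (f 2) (f 3) = 0 := congr_fun h 0
  have h1 : F (f 0) (f 2) + F (f 3) (f 1) = 0 := congr_fun h 1
  have h2 : F (f 0) (f 3) + F (f 1) (f 2) = 0 := congr_fun h 2
  rw [hskew (f 3) (f 1), ← sub_eq_add_neg, sub_eq_zero] at h1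
  exact ⟨eq_neg_of_add_eq_zero_right h0, h1.symm, eq_neg_of_add_eq_zero_right h2⟩

/-- **Anti-self-duality survives a Givens rotation in the `(2,3)`-plane**: the self-dual components
become `(F⁺₀, c F⁺₁ + s F⁺₂, -s F⁺₁ + c F⁺₂)` (the rotation of `Λ²₊ ≅ ℝ³` about the first axis),
so they vanish after the rotation if they vanished before (Atiyah–Hitchin–Singer 1978, §1:
`Λ²₊` is `SO(4)`-stable). [cite: AtiyahHitchinSinger1978, §1] -/
theorem IsASDIn.frame_rot23 (hadd : ∀ u u' v, F (u + u') v = F u v + F u' v)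
    (hsmul : ∀ (c : ℝ) (u v : V), F (c • u) v = c • F u v) (hskew : ∀ u v, F u v = -F v u)
    {f : Fin 4 → V} (h : IsASDIn F f) {c s : ℝ} (hcs : c ^ 2 + s ^ 2 = 1) :
    IsASDIn F ![f 0, f 1, c • f 2 + s • f 3, -s • f 2 + c • f 3] := by
  have h0 : F (f 0) (f 1) + F (f 2) (f 3) = 0 := congr_fun h 0
  obtain ⟨-, e13, e12⟩ := h.rel_of_skew hskew
  have hcs' : c * c - s * -s = 1 := by linear_combination hcs
  unfold IsASDIn sdComponents
  funext i
  fin_cases i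
  · show F (f 0) (f 1) + F (c • f 2 + s • f 3) (-s • f 2 + c • f 3) = 0
    rw [skew_apply_combo hadd hsmul hskew, hcs', one_smul]
    exact h0
  · show F (f 0) (c • f 2 + s • f 3) + F (-s • f 2 + c • f 3) (f 1) = 0
    rw [skew_apply_right_combo hadd hsmul hskew, skew_apply_left_combo hadd hsmul,
      hskew (f 2) (f 1), hskew (f 3) (f 1), e13, e12]
    module
  · show F (f 0) (-s • f 2 + c • f 3) + F (f 1) (c • f 2 + s • f 3) = 0
    rw [skew_apply_right_combo hadd hsmul hskew, skew_apply_right_combo hadd hsmul hskew, e13,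
      e12]
    module

/-- **Anti-self-duality survives a Givens rotation in the `(1,2)`-plane** (the self-dual
components become `(c F⁺₀ + s F⁺₁, -s F⁺₀ + c F⁺₁, F⁺₂)`). [cite: AtiyahHitchinSinger1978, §1] -/
theorem IsASDIn.frame_rot12 (hadd : ∀ u u' v, F (u + u') v = F u v + F u' v)
    (hsmul : ∀ (c : ℝ) (u v : V), F (c • u) v = c • F u v) (hskew : ∀ u v, F u v = -F v u)
    {f : Fin 4 → V} (h : IsASDIn F f) {c s : ℝ} (hcs : c ^ 2 + s ^ 2 = 1) :
    IsASDIn F ![f 0, c • f 1 + s • f 2, -s • f 1 + c • f 2, f 3] := by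
  have h2 : F (f 0) (f 3) + F (f 1) (f 2) = 0 := congr_fun h 2
  obtain ⟨e23, e13, -⟩ := h.rel_of_skew hskew
  have hcs' : c * c - s * -s = 1 := by linear_combination hcs
  unfold IsASDIn sdComponents
  funext i
  fin_cases i
  · show F (f 0) (c • f 1 + s • f 2) + F (-s • f 1 + c • f 2) (f 3) = 0
    rw [skew_apply_right_combo hadd hsmul hskew, skew_apply_left_combo hadd hsmul, e13, e23]
    module
  · show F (f 0) (-s • f 1 + c • f 2) + F (f 3) (c • f 1 + s • f 2) = 0
    rw [skew_apply_right_combo hadd hsmul hskew, skew_apply_right_combo hadd hsmul hskew,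
      hskew (f 3) (f 1), hskew (f 3) (f 2), e13, e23]
    module
  · show F (f 0) (f 3) + F (c • f 1 + s • f 2) (-s • f 1 + c • f 2) = 0
    rw [skew_apply_combo hadd hsmul hskew, hcs', one_smul]
    exact h2

/-- **Anti-self-duality survives a Givens rotation in the `(0,1)`-plane** (the self-dual
components become `(F⁺₀, c F⁺₁ + s F⁺₂, -s F⁺₁ + c F⁺₂)`). [cite: AtiyahHitchinSinger1978, §1] -/
theorem IsASDIn.frame_rot01 (hadd : ∀ u u' v, F (u + u') v = F u v + F u' v)
    (hsmul : ∀ (c : ℝ) (u v : V), F (c • u) v = c • F u v) (hskew : ∀ u v, F u v = -F v u)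
    {f : Fin 4 → V} (h : IsASDIn F f) {c s : ℝ} (hcs : c ^ 2 + s ^ 2 = 1) :
    IsASDIn F ![c • f 0 + s • f 1, -s • f 0 + c • f 1, f 2, f 3] := by
  have h0 : F (f 0) (f 1) + F (f 2) (f 3) = 0 := congr_fun h 0
  obtain ⟨-, e13, e12⟩ := h.rel_of_skew hskew
  have hcs' : c * c - s * -s = 1 := by linear_combination hcs
  unfold IsASDIn sdComponents
  funext i
  fin_cases i
  · show F (c • f 0 + s • f 1) (-s • f 0 + c • f 1) + F (f 2) (f 3) = 0
    rw [skew_apply_combo hadd hsmul hskew, hcs', one_smul]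
    exact h0
  · show F (c • f 0 + s • f 1) (f 2) + F (f 3) (-s • f 0 + c • f 1) = 0
    rw [skew_apply_left_combo hadd hsmul, skew_apply_right_combo hadd hsmul hskew,
      hskew (f 3) (f 0), hskew (f 3) (f 1), e13, e12]
    module
  · show F (c • f 0 + s • f 1) (f 3) + F (-s • f 0 + c • f 1) (f 2) = 0
    rw [skew_apply_left_combo hadd hsmul, skew_apply_left_combo hadd hsmul, e13, e12]
    module

/-- The six-term sum `Σ_{a<b} |F(f_a, f_b)|²` behind `twoFormNormSq`, written out. [folklore] -/
theorem sum_sum_ite_lt_fin_four {R : Type*} [AddCommMonoid R] (φ : Fin 4 → Fin 4 → R)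
    {d : (a b : Fin 4) → Decidable (a < b)} :
    (∑ a, ∑ b, @ite _ (a < b) (d a b) (φ a b) 0) =
      φ 0 1 + φ 0 2 + φ 0 3 + φ 1 2 + φ 1 3 + φ 2 3 := by
  have hd : d = fun a b ↦ Fin.decLt a b := Subsingleton.elim _ _
  subst hd
  simp only [Fin.sum_univ_four, Fin.isValue, Fin.reduceLT, ↓reduceIte, zero_add, add_zero,
    add_assoc]

/-- **Norms on a plane rotation**: `‖c A + s B‖² + ‖-s A + c B‖² = ‖A‖² + ‖B‖²` for
`c² + s² = 1` in a real inner product space. [folklore] -/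
theorem norm_sq_rot_add_norm_sq_rot {W : Type*} [NormedAddCommGroup W] [InnerProductSpace ℝ W]
    (A B : W) {c s : ℝ} (hcs : c ^ 2 + s ^ 2 = 1) :
    ‖c • A + s • B‖ ^ 2 + ‖-s • A + c • B‖ ^ 2 = ‖A‖ ^ 2 + ‖B‖ ^ 2 := by
  rw [norm_add_sq_real, norm_add_sq_real]
  simp only [norm_smul, real_inner_smul_left, real_inner_smul_right, Real.norm_eq_abs, mul_pow,
    sq_abs]
  linear_combination (‖A‖ ^ 2 + ‖B‖ ^ 2) * hcs

/-- `Σ_{a<b} |F(f_a, f_b)|²` is unchanged by a Givens rotation of the frame in the `(2,3)`-plane.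
[folklore] -/
theorem six_adNormSq_frame_rot23 (hadd : ∀ u u' v, F (u + u') v = F u v + F u' v)
    (hsmul : ∀ (c : ℝ) (u v : V), F (c • u) v = c • F u v) (hskew : ∀ u v, F u v = -F v u)
    (f : Fin 4 → V) {c s : ℝ} (hcs : c ^ 2 + s ^ 2 = 1) :
    adNormSq (F (f 0) (f 1)) + adNormSq (F (f 0) (c • f 2 + s • f 3)) +
        adNormSq (F (f 0) (-s • f 2 + c • f 3)) + adNormSq (F (f 1) (c • f 2 + s • f 3)) +
        adNormSq (F (f 1) (-s • f 2 + c • f 3)) +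
        adNormSq (F (c • f 2 + s • f 3) (-s • f 2 + c • f 3)) =
      adNormSq (F (f 0) (f 1)) + adNormSq (F (f 0) (f 2)) + adNormSq (F (f 0) (f 3)) +
        adNormSq (F (f 1) (f 2)) + adNormSq (F (f 1) (f 3)) + adNormSq (F (f 2) (f 3)) := by
  have hcs' : c * c - s * -s = 1 := by linear_combination hcs
  have h0 := norm_sq_rot_add_norm_sq_rot (F (f 0) (f 2)) (F (f 0) (f 3)) hcs
  have h1 := norm_sq_rot_add_norm_sq_rot (F (f 1) (f 2)) (F (f 1) (f 3)) hcs
  have q23 : F (c • f 2 + s • f 3) (-s • f 2 + c • f 3) = F (f 2) (f 3) := by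
    rw [skew_apply_combo hadd hsmul hskew, hcs', one_smul]
  rw [q23, skew_apply_right_combo hadd hsmul hskew c s (f 0),
    skew_apply_right_combo hadd hsmul hskew (-s) c (f 0),
    skew_apply_right_combo hadd hsmul hskew c s (f 1),
    skew_apply_right_combo hadd hsmul hskew (-s) c (f 1)]
  unfold adNormSq
  linear_combination 2 * h0 + 2 * h1

/-- `Σ_{a<b} |F(f_a, f_b)|²` is unchanged by a Givens rotation of the frame in the `(1,2)`-plane.
[folklore] -/
theorem six_adNormSq_frame_rot12 (hadd : ∀ u u' v, F (u + u') v = F u v + F u' v)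
    (hsmul : ∀ (c : ℝ) (u v : V), F (c • u) v = c • F u v) (hskew : ∀ u v, F u v = -F v u)
    (f : Fin 4 → V) {c s : ℝ} (hcs : c ^ 2 + s ^ 2 = 1) :
    adNormSq (F (f 0) (c • f 1 + s • f 2)) + adNormSq (F (f 0) (-s • f 1 + c • f 2)) +
        adNormSq (F (f 0) (f 3)) + adNormSq (F (c • f 1 + s • f 2) (-s • f 1 + c • f 2)) +
        adNormSq (F (c • f 1 + s • f 2) (f 3)) + adNormSq (F (-s • f 1 + c • f 2) (f 3)) =
      adNormSq (F (f 0) (f 1)) + adNormSq (F (f 0) (f 2)) + adNormSq (F (f 0) (f 3)) +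
        adNormSq (F (f 1) (f 2)) + adNormSq (F (f 1) (f 3)) + adNormSq (F (f 2) (f 3)) := by
  have hcs' : c * c - s * -s = 1 := by linear_combination hcs
  have h0 := norm_sq_rot_add_norm_sq_rot (F (f 0) (f 1)) (F (f 0) (f 2)) hcs
  have h1 := norm_sq_rot_add_norm_sq_rot (F (f 1) (f 3)) (F (f 2) (f 3)) hcs
  have q12 : F (c • f 1 + s • f 2) (-s • f 1 + c • f 2) = F (f 1) (f 2) := by
    rw [skew_apply_combo hadd hsmul hskew, hcs', one_smul]
  rw [q12, skew_apply_right_combo hadd hsmul hskew c s (f 0),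
    skew_apply_right_combo hadd hsmul hskew (-s) c (f 0),
    skew_apply_left_combo hadd hsmul c s (f 1) (f 2) (f 3),
    skew_apply_left_combo hadd hsmul (-s) c (f 1) (f 2) (f 3)]
  unfold adNormSq
  linear_combination 2 * h0 + 2 * h1

/-- `Σ_{a<b} |F(f_a, f_b)|²` is unchanged by a Givens rotation of the frame in the `(0,1)`-plane.
[folklore] -/
theorem six_adNormSq_frame_rot01 (hadd : ∀ u u' v, F (u + u') v = F u v + F u' v)
    (hsmul : ∀ (c : ℝ) (u v : V), F (c • u) v = c • F u v) (hskew : ∀ u v, F u v = -F v u)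
    (f : Fin 4 → V) {c s : ℝ} (hcs : c ^ 2 + s ^ 2 = 1) :
    adNormSq (F (c • f 0 + s • f 1) (-s • f 0 + c • f 1)) + adNormSq (F (c • f 0 + s • f 1) (f 2)) +
        adNormSq (F (c • f 0 + s • f 1) (f 3)) + adNormSq (F (-s • f 0 + c • f 1) (f 2)) +
        adNormSq (F (-s • f 0 + c • f 1) (f 3)) + adNormSq (F (f 2) (f 3)) =
      adNormSq (F (f 0) (f 1)) + adNormSq (F (f 0) (f 2)) + adNormSq (F (f 0) (f 3)) +
        adNormSq (F (f 1) (f 2)) + adNormSq (F (f 1) (f 3)) + adNormSq (F (f 2) (f 3)) := by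
  have hcs' : c * c - s * -s = 1 := by linear_combination hcs
  have h0 := norm_sq_rot_add_norm_sq_rot (F (f 0) (f 2)) (F (f 1) (f 2)) hcs
  have h1 := norm_sq_rot_add_norm_sq_rot (F (f 0) (f 3)) (F (f 1) (f 3)) hcs
  have q01 : F (c • f 0 + s • f 1) (-s • f 0 + c • f 1) = F (f 0) (f 1) := by
    rw [skew_apply_combo hadd hsmul hskew, hcs', one_smul]
  rw [q01, skew_apply_left_combo hadd hsmul c s (f 0) (f 1) (f 2),
    skew_apply_left_combo hadd hsmul c s (f 0) (f 1) (f 3),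
    skew_apply_left_combo hadd hsmul (-s) c (f 0) (f 1) (f 2),
    skew_apply_left_combo hadd hsmul (-s) c (f 0) (f 1) (f 3)]
  unfold adNormSq
  linear_combination 2 * h0 + 2 * h1

/-- `Σ_{a<b} |F(f_a, f_b)|²` is unchanged by the reversal of the first frame vector. [folklore] -/
theorem six_adNormSq_update_neg (hsmul : ∀ (c : ℝ) (u v : V), F (c • u) v = c • F u v)
    (f : Fin 4 → V) :
    adNormSq (F (update f 0 (-f 0) 0) (update f 0 (-f 0) 1)) +
        adNormSq (F (update f 0 (-f 0) 0) (update f 0 (-f 0) 2)) +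
        adNormSq (F (update f 0 (-f 0) 0) (update f 0 (-f 0) 3)) +
        adNormSq (F (update f 0 (-f 0) 1) (update f 0 (-f 0) 2)) +
        adNormSq (F (update f 0 (-f 0) 1) (update f 0 (-f 0) 3)) +
        adNormSq (F (update f 0 (-f 0) 2) (update f 0 (-f 0) 3)) =
      adNormSq (F (f 0) (f 1)) + adNormSq (F (f 0) (f 2)) + adNormSq (F (f 0) (f 3)) +
        adNormSq (F (f 1) (f 2)) + adNormSq (F (f 1) (f 3)) + adNormSq (F (f 2) (f 3)) := by
  have hneg : ∀ v, F (-f 0) v = -F (f 0) v := fun v ↦ by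
    rw [← neg_one_smul ℝ (f 0), hsmul, neg_one_smul]
  simp only [update_self, ne_eq, one_ne_zero, not_false_eq_true, update_of_ne, Fin.isValue,
    show (2 : Fin 4) ≠ 0 from by decide, show (3 : Fin 4) ≠ 0 from by decide, hneg, adNormSq,
    norm_neg]

end SkewForm

/-! ### Frame independence at a point of an oriented Riemannian 4-manifold -/

section Frame

variable {X : Type*} [TopologicalSpace X] [ChartedSpace (EuclideanSpace ℝ (Fin 4)) X] [IsManifold (𝓡 4) ∞ X]
  (g : PseudoRiemannianMetric (𝓡 4) ∞ (EuclideanSpace ℝ (Fin 4)) (TangentSpace (𝓡 4) : X → Type _))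
  (o : SmoothOrientation (𝓡 4) X)

/-- **Anti-self-duality does not depend on the positive orthonormal frame.** At a point `x` of an
oriented 4-manifold with metric `g`, a skew bi-additive `ℍ`-valued 2-form which is anti-self-dual
(`F⁺ = 0`, frame-wise `IsASDIn`) in one positively oriented `g_x`-orthonormal frame is
anti-self-dual in every other: the self-dual subspace `Λ²₊ ⊂ Λ²T*_x` is invariant under `SO(4)`
(Atiyah–Hitchin–Singer 1978, §1), frame-wise via `IsOrthonormalFrame.givens_induction` and
`IsASDIn.frame_rot01/12/23`. [cite: AtiyahHitchinSinger1978, §1] -/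
theorem IsASDIn.of_isPosOrthonormalFrame {x : X}
    {F : TangentSpace (𝓡 4) x → TangentSpace (𝓡 4) x → ℍ}
    (hadd : ∀ u u' v, F (u + u') v = F u v + F u' v)
    (hsmul : ∀ (c : ℝ) (u v : TangentSpace (𝓡 4) x), F (c • u) v = c • F u v)
    (hskew : ∀ u v, F u v = -F v u) {e e' : Fin 4 → TangentSpace (𝓡 4) x}
    (he : IsPosOrthonormalFrame g o x e) (he' : IsPosOrthonormalFrame g o x e')
    (h : IsASDIn F e) : IsASDIn F e' := by
  obtain ⟨vol, hvol⟩ := exists_alternating_pos_of_isPosFrame o x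
  exact he.1.givens_induction finrank_euclideanSpace_fin (IsASDIn F)
    (fun f c s hcs hf ↦ hf.frame_rot01 hadd hsmul hskew hcs)
    (fun f c s hcs hf ↦ hf.frame_rot12 hadd hsmul hskew hcs)
    (fun f c s hcs hf ↦ hf.frame_rot23 hadd hsmul hskew hcs) vol he'.1 (hvol e e' he.2 he'.2) h

/-- **Anti-self-duality is frame independent** (iff form): for two positively oriented
`g_x`-orthonormal frames, `F⁺ = 0` in one iff in the other (Atiyah–Hitchin–Singer 1978, §1).
[cite: AtiyahHitchinSinger1978, §1] -/
theorem isASDIn_iff_of_isPosOrthonormalFrame {x : X}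
    {F : TangentSpace (𝓡 4) x → TangentSpace (𝓡 4) x → ℍ}
    (hadd : ∀ u u' v, F (u + u') v = F u v + F u' v)
    (hsmul : ∀ (c : ℝ) (u v : TangentSpace (𝓡 4) x), F (c • u) v = c • F u v)
    (hskew : ∀ u v, F u v = -F v u) {e e' : Fin 4 → TangentSpace (𝓡 4) x}
    (he : IsPosOrthonormalFrame g o x e) (he' : IsPosOrthonormalFrame g o x e') :
    IsASDIn F e ↔ IsASDIn F e' :=
  ⟨IsASDIn.of_isPosOrthonormalFrame g o hadd hsmul hskew he he',
    IsASDIn.of_isPosOrthonormalFrame g o hadd hsmul hskew he' he⟩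

/-- **`Σ_{a<b} |F(e_a, e_b)|²` is the same in all orthonormal frames** (of either orientation):
it is the norm induced by `g_x` on `Λ²T*_x ⊗ ℍ`, invariant under `O(4)` (Donaldson–Kronheimer 1990,
§2.1), frame-wise via `IsOrthonormalFrame.givens_induction_neg`. [cite: DonaldsonKronheimer1990, §2.1] -/
theorem six_adNormSq_eq_of_isOrthonormalFrame {x : X}
    {F : TangentSpace (𝓡 4) x → TangentSpace (𝓡 4) x → ℍ}
    (hadd : ∀ u u' v, F (u + u') v = F u v + F u' v)
    (hsmul : ∀ (c : ℝ) (u v : TangentSpace (𝓡 4) x), F (c • u) v = c • F u v)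
    (hskew : ∀ u v, F u v = -F v u) {e e' : Fin 4 → TangentSpace (𝓡 4) x}
    (he : g.IsOrthonormalFrame x e) (he' : g.IsOrthonormalFrame x e') :
    adNormSq (F (e' 0) (e' 1)) + adNormSq (F (e' 0) (e' 2)) + adNormSq (F (e' 0) (e' 3)) +
        adNormSq (F (e' 1) (e' 2)) + adNormSq (F (e' 1) (e' 3)) + adNormSq (F (e' 2) (e' 3)) =
      adNormSq (F (e 0) (e 1)) + adNormSq (F (e 0) (e 2)) + adNormSq (F (e 0) (e 3)) +
        adNormSq (F (e 1) (e 2)) + adNormSq (F (e 1) (e 3)) + adNormSq (F (e 2) (e 3)) := by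
  refine he.givens_induction_neg finrank_euclideanSpace_fin
    (fun f ↦ adNormSq (F (f 0) (f 1)) + adNormSq (F (f 0) (f 2)) + adNormSq (F (f 0) (f 3)) +
        adNormSq (F (f 1) (f 2)) + adNormSq (F (f 1) (f 3)) + adNormSq (F (f 2) (f 3)) =
      adNormSq (F (e 0) (e 1)) + adNormSq (F (e 0) (e 2)) + adNormSq (F (e 0) (e 3)) +
        adNormSq (F (e 1) (e 2)) + adNormSq (F (e 1) (e 3)) + adNormSq (F (e 2) (e 3)))
    (fun f c s hcs hf ↦ ?_) (fun f c s hcs hf ↦ ?_) (fun f c s hcs hf ↦ ?_) (fun f hf ↦ ?_)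
    he' rfl
  · beta_reduce at hf ⊢
    rw [← hf]
    exact six_adNormSq_frame_rot01 hadd hsmul hskew f hcs
  · beta_reduce at hf ⊢
    rw [← hf]
    exact six_adNormSq_frame_rot12 hadd hsmul hskew f hcs
  · beta_reduce at hf ⊢
    rw [← hf]
    exact six_adNormSq_frame_rot23 hadd hsmul hskew f hcs
  · beta_reduce at hf ⊢
    rw [← hf]
    exact six_adNormSq_update_neg hsmul f

/-- **The pointwise norm `|F|²_g(x)` may be computed in any orthonormal frame**: for a skew
bi-additive `F` and every `g_x`-orthonormal frame `e`,
`twoFormNormSq g x F = Σ_{a<b} |F(e_a, e_b)|²` — the definition evaluates the sum on a *chosen*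
orthonormal frame, and the sum does not depend on the choice (Donaldson–Kronheimer 1990, §2.1:
`|F|²` is the norm induced by the metric). [cite: DonaldsonKronheimer1990, §2.1] -/
theorem twoFormNormSq_eq_of_isOrthonormalFrame {x : X}
    {F : TangentSpace (𝓡 4) x → TangentSpace (𝓡 4) x → ℍ}
    (hadd : ∀ u u' v, F (u + u') v = F u v + F u' v)
    (hsmul : ∀ (c : ℝ) (u v : TangentSpace (𝓡 4) x), F (c • u) v = c • F u v)
    (hskew : ∀ u v, F u v = -F v u) {e : Fin 4 → TangentSpace (𝓡 4) x}
    (he : g.IsOrthonormalFrame x e) :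
    twoFormNormSq g x F = ∑ a, ∑ b, if a < b then adNormSq (F (e a) (e b)) else 0 := by
  have hex : ∃ e : Fin 4 → TangentSpace (𝓡 4) x, g.IsOrthonormalFrame x e := ⟨e, he⟩
  unfold twoFormNormSq
  rw [dif_pos hex, sum_sum_ite_lt_fin_four, sum_sum_ite_lt_fin_four]
  exact six_adNormSq_eq_of_isOrthonormalFrame g hadd hsmul hskew he hex.choose_spec

/-- Written-out form: `|F|²_g(x) = |F₀₁|² + |F₀₂|² + |F₀₃|² + |F₁₂|² + |F₁₃|² + |F₂₃|²` in any
`g_x`-orthonormal frame. [cite: DonaldsonKronheimer1990, §2.1] -/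
theorem twoFormNormSq_eq_six_of_isOrthonormalFrame {x : X}
    {F : TangentSpace (𝓡 4) x → TangentSpace (𝓡 4) x → ℍ}
    (hadd : ∀ u u' v, F (u + u') v = F u v + F u' v)
    (hsmul : ∀ (c : ℝ) (u v : TangentSpace (𝓡 4) x), F (c • u) v = c • F u v)
    (hskew : ∀ u v, F u v = -F v u) {e : Fin 4 → TangentSpace (𝓡 4) x}
    (he : g.IsOrthonormalFrame x e) :
    twoFormNormSq g x F = adNormSq (F (e 0) (e 1)) + adNormSq (F (e 0) (e 2)) +
      adNormSq (F (e 0) (e 3)) + adNormSq (F (e 1) (e 2)) + adNormSq (F (e 1) (e 3)) +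
      adNormSq (F (e 2) (e 3)) := by
  rw [twoFormNormSq_eq_of_isOrthonormalFrame g hadd hsmul hskew he, sum_sum_ite_lt_fin_four]

/-- If `g_x` admits no orthonormal 4-frame (it is not positive definite), `|F|²_g(x)` is the junk
value `0`. [folklore] -/
theorem twoFormNormSq_of_not_exists {x : X}
    (F : TangentSpace (𝓡 4) x → TangentSpace (𝓡 4) x → ℍ)
    (h : ¬ ∃ e : Fin 4 → TangentSpace (𝓡 4) x, g.IsOrthonormalFrame x e) :
    twoFormNormSq g x F = 0 := by
  unfold twoFormNormSq
  rw [dif_neg h]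

end Frame

/-! ### The curvature of a connection is a skew bi-additive 2-form -/

section Curvature

variable {X : Type*} [TopologicalSpace X] [ChartedSpace (EuclideanSpace ℝ (Fin 4)) X]

namespace QuatOneForm

/-- `dB(x)` is additive in its first argument (it is an alternating bilinear map). [folklore] -/
theorem extDeriv_add_left (B : QuatOneForm X) (x : X) (u u' v : TangentSpace (𝓡 4) x) :
    B.extDeriv x (u + u') v = B.extDeriv x u v + B.extDeriv x u' v :=
  (Literature.Geometry.Kaehler.mextDeriv B.toMForm x).toAlternatingMap.map_vecCons_add ![v] u u'

/-- `dB(x)` is homogeneous in its first argument. [folklore] -/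
theorem extDeriv_smul_left (B : QuatOneForm X) (x : X) (c : ℝ) (u v : TangentSpace (𝓡 4) x) :
    B.extDeriv x (c • u) v = c • B.extDeriv x u v :=
  (Literature.Geometry.Kaehler.mextDeriv B.toMForm x).toAlternatingMap.map_vecCons_smul ![v] c u

/-- `dB(x)` is skew: `dB(v, u) = -dB(u, v)`. [folklore] -/
theorem extDeriv_swap (B : QuatOneForm X) (x : X) (u v : TangentSpace (𝓡 4) x) :
    B.extDeriv x v u = -B.extDeriv x u v := by
  have h := (Literature.Geometry.Kaehler.mextDeriv B.toMForm x).toAlternatingMap.map_swap ![u, v]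
    (show (0 : Fin 2) ≠ 1 by decide)
  have hsw : ![u, v] ∘ Equiv.swap (0 : Fin 2) 1 = ![v, u] := by
    funext i
    fin_cases i <;> simp
  rw [hsw] at h
  exact h

end QuatOneForm

variable [IsManifold (𝓡 4) ∞ X]

namespace SpOneConnection

variable {o : SmoothOrientation (𝓡 4) X} {k : ℤ} {p : X}

/-- **The curvature is additive in its first argument**: `F(u + u', v) = F(u, v) + F(u', v)`
(`F = dA + A ∧ A` with `dA` alternating bilinear and `A(x)` linear). [folklore] -/
theorem curvature_add_left (A : SpOneConnection o k p) (i : Fin 2) (x : X)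
    (u u' v : TangentSpace (𝓡 4) x) :
    A.curvature i x (u + u') v = A.curvature i x u v + A.curvature i x u' v := by
  simp only [curvature, QuatOneForm.extDeriv_add_left, map_add]
  noncomm_ring

/-- **The curvature is homogeneous in its first argument**: `F(c u, v) = c F(u, v)`. [folklore] -/
theorem curvature_smul_left (A : SpOneConnection o k p) (i : Fin 2) (x : X) (c : ℝ)
    (u v : TangentSpace (𝓡 4) x) :
    A.curvature i x (c • u) v = c • A.curvature i x u v := by
  simp only [curvature, QuatOneForm.extDeriv_smul_left, map_smul, smul_mul_assoc, mul_smul_comm,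
    smul_add, smul_sub]

/-- **The curvature is skew**: `F(v, u) = -F(u, v)` (a 2-form). [folklore] -/
theorem curvature_swap (A : SpOneConnection o k p) (i : Fin 2) (x : X)
    (u v : TangentSpace (𝓡 4) x) :
    A.curvature i x v u = -A.curvature i x u v := by
  simp only [curvature]
  rw [QuatOneForm.extDeriv_swap (A.form i) x u v]
  abel

variable (g : PseudoRiemannianMetric (𝓡 4) ∞ (EuclideanSpace ℝ (Fin 4)) (TangentSpace (𝓡 4) : X → Type _))

/-- **Anti-self-duality may be tested on one positive orthonormal frame per point**: if at every
point of each patch the curvature is anti-self-dual in SOME positively oriented `g`-orthonormal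
frame, the connection is `g`-anti-self-dual (`IsASD` asks it in every such frame; the two agree
by `IsASDIn.of_isPosOrthonormalFrame`, Atiyah–Hitchin–Singer 1978, §1). [cite: AtiyahHitchinSinger1978, §1] -/
theorem isASD_of_forall_exists {A : SpOneConnection o k p}
    (h : ∀ i, ∀ x ∈ patch p i, ∃ e, IsPosOrthonormalFrame g o x e ∧ IsASDIn (A.curvature i x) e) :
    A.IsASD g := by
  intro i x hx e he
  obtain ⟨e₀, he₀, h₀⟩ := h i x hx
  exact IsASDIn.of_isPosOrthonormalFrame g o (A.curvature_add_left i x) (A.curvature_smul_left i x)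
    (fun u v ↦ A.curvature_swap i x v u) he₀ he h₀

/-- **Anti-self-duality, one frame per point** (iff form, Riemannian `g`, where positive
orthonormal frames exist at every point, `exists_isOrthonormalFrame_isPosFrame`): `A` is
`g`-anti-self-dual iff at every point of each patch its curvature is anti-self-dual in some
positively oriented `g`-orthonormal frame. [cite: AtiyahHitchinSinger1978, §1] -/
theorem isASD_iff_forall_exists (hg : g.IsRiemannian) {A : SpOneConnection o k p} :
    A.IsASD g ↔
      ∀ i, ∀ x ∈ patch p i, ∃ e, IsPosOrthonormalFrame g o x e ∧ IsASDIn (A.curvature i x) e := by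
  refine ⟨fun h i x hx ↦ ?_, isASD_of_forall_exists g⟩
  obtain ⟨e, he, hpos⟩ := exists_isOrthonormalFrame_isPosFrame hg o x
  exact ⟨e, ⟨he, hpos⟩, h i x hx e ⟨he, hpos⟩⟩

/-- **The curvature density in any orthonormal frame**: `ρ_A(x) = Σ_{a<b} |F_A(e_a, e_b)|²` for
every `g_x`-orthonormal frame `e` (read through the patch of `x`), not only the frame chosen by
`twoFormNormSq` (Donaldson–Kronheimer 1990, §2.1). [cite: DonaldsonKronheimer1990, §2.1] -/
theorem curvatureDensity_eq_sum (A : SpOneConnection o k p) {x : X}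
    {e : Fin 4 → TangentSpace (𝓡 4) x} (he : g.IsOrthonormalFrame x e) :
    A.curvatureDensity g x =
      ∑ a, ∑ b, if a < b then adNormSq (A.curvature (patchIndex p x) x (e a) (e b)) else 0 :=
  twoFormNormSq_eq_of_isOrthonormalFrame g (A.curvature_add_left _ x) (A.curvature_smul_left _ x)
    (fun u v ↦ A.curvature_swap _ x v u) he

/-- Written-out form of `curvatureDensity_eq_sum`:
`ρ_A(x) = |F₀₁|² + |F₀₂|² + |F₀₃|² + |F₁₂|² + |F₁₃|² + |F₂₃|²` in any `g_x`-orthonormal frame.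
[cite: DonaldsonKronheimer1990, §2.1] -/
theorem curvatureDensity_eq_six (A : SpOneConnection o k p) {x : X}
    {e : Fin 4 → TangentSpace (𝓡 4) x} (he : g.IsOrthonormalFrame x e) :
    A.curvatureDensity g x =
      adNormSq (A.curvature (patchIndex p x) x (e 0) (e 1)) +
        adNormSq (A.curvature (patchIndex p x) x (e 0) (e 2)) +
        adNormSq (A.curvature (patchIndex p x) x (e 0) (e 3)) +
        adNormSq (A.curvature (patchIndex p x) x (e 1) (e 2)) +
        adNormSq (A.curvature (patchIndex p x) x (e 1) (e 3)) +
        adNormSq (A.curvature (patchIndex p x) x (e 2) (e 3)) := by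
  rw [A.curvatureDensity_eq_sum g he, sum_sum_ite_lt_fin_four]

/-- **In an anti-self-dual frame the density is twice the sum over the three "electric" pairs**:
if `F` is anti-self-dual in the `g_x`-orthonormal frame `e` then
`ρ_A(x) = 2 (|F₀₁|² + |F₀₂|² + |F₀₃|²)` (`F₂₃ = -F₀₁`, `F₃₁ = -F₀₂`, `F₁₂ = -F₀₃`).
[cite: DonaldsonKronheimer1990, §2.1] -/
theorem curvatureDensity_eq_of_isASDIn (A : SpOneConnection o k p) {x : X}
    {e : Fin 4 → TangentSpace (𝓡 4) x} (he : g.IsOrthonormalFrame x e)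
    (hF : IsASDIn (A.curvature (patchIndex p x) x) e) :
    A.curvatureDensity g x =
      2 * (adNormSq (A.curvature (patchIndex p x) x (e 0) (e 1)) +
        adNormSq (A.curvature (patchIndex p x) x (e 0) (e 2)) +
        adNormSq (A.curvature (patchIndex p x) x (e 0) (e 3))) := by
  obtain ⟨e23, e13, e12⟩ := hF.rel_of_skew (fun u v ↦ A.curvature_swap _ x v u)
  rw [A.curvatureDensity_eq_six g he, e23, e12, e13]
  simp only [adNormSq, norm_neg]
  ring

end SpOneConnection

namespace AsdModuliSpace

variable [Nonempty X]
  {g : PseudoRiemannianMetric (𝓡 4) ∞ (EuclideanSpace ℝ (Fin 4)) (TangentSpace (𝓡 4) : X → Type _)}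
  {o : SmoothOrientation (𝓡 4) X} {k : ℤ}

/-- **The curvature density of a class in any orthonormal frame**:
`ρ_[A](x) = Σ_{a<b} |F_A(e_a, e_b)|²` for the representative `A = c.out` and every
`g_x`-orthonormal frame `e` (Donaldson–Kronheimer 1990, §2.1). [cite: DonaldsonKronheimer1990, §2.1] -/
theorem density_eq_sum (c : AsdModuliSpace g o k) {x : X} {e : Fin 4 → TangentSpace (𝓡 4) x}
    (he : g.IsOrthonormalFrame x e) :
    c.density g x = ∑ a, ∑ b,
      if a < b then adNormSq (c.out.1.curvature (SpOneConnection.patchIndex (basePoint X) x) x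
        (e a) (e b)) else 0 :=
  c.out.1.curvatureDensity_eq_sum g he

end AsdModuliSpace

end Curvature

end Literature.Geometry.GaugeTheory

end
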